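import Mathlib

/-!
# Rigidity of unramified Euler factors under a functional equation — the algebraic kernel of the
# L-function line for the RAMIFIED clause of `StrongLiftingAllFinite` (item stmt-Langlands-15194)

Route `SkinnerWilesDefectOne`, item `StrongLiftingAllFinite` (= Arthur–Clozel 1989, Ch. 3, Thm. 5.1
at ALL finite places).  Its residue splits (`SkinnerWilesDefectOneStrongLiftingAllFinite`) into the
clause at the places unramified in `E/F` (named leaves of the tree) and the RAMIFIED CLAUSE (R): at a
place `v₀` of `F` ramified in the cyclic prime-degree extension `E/F` (so `f(w₀|v₀) = 1`,
`q_{w₀} = q_{v₀} = q`) at which `π` is unramified with Satake parameter `α`, the cuspidal weak lift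
`P` is unramified at `w₀` with the SAME Satake parameter.  Arthur–Clozel prove (R) with the full
twisted trace identity at `v₀` and the local lifting of Ch. 1 §6.  A trace-formula-free line: compare
the functional equations of `Λ(s, P)` and `∏_{i mod ℓ} Λ(s, π ⊗ ηⁱ)` (Godement–Jacquet), whose Euler
factors agree off `S = Ram(π) ∪ Ram(E/F)`; the quotient is a finite Euler product satisfying
`∏_{v ∈ S} A_v(q_v^{-s}) = C · M^s · ∏_{v ∈ S} Ã_v(q_v^{s-1})`; separate the rational primes
(`{log p}` is `ℤ`-free — file `…LFactorPrimeSeparation`), and at `v₀` read off the local factor of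
`P_{w₀}`.  With `L(s, P_{w₀}) = ∏_i (1 - u_i q^{-s})⁻¹` over the blocks `St_{m_i}(χ_i)` of the
generic `P_{w₀}` (`u_i = χ_i(ϖ) q^{-(m_i-1)/2}`, `χ_i` unramified) and
`L(s, P̃_{w₀}) = ∏_i (1 - u_i⁻¹ q^{-(m_i-1)} q^{-s})⁻¹`, the single-prime identity is the POLYNOMIAL
identity

  `∏_{a ∈ α} (1 - aX) · ∏_i (1 - u_i q^{m_i} X) = ∏_{a ∈ α} (1 - q a X) · ∏_i (1 - u_i X)`.

THIS FILE proves that this identity is rigid (pure algebra over `ℂ`, no automorphic input):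

* `multiset_eq_of_add_map_mul_eq` — **min-modulus lemma**: for `1 < ‖q‖` and multisets `A`, `B` of
  non-zero complex numbers, `A + q•B = q•A + B` forces `A = B` (an element of least modulus of `A + B`
  lies in both).
* `multiset_eq_of_prod_one_sub_C_mul_X_eq` — `∏_{a ∈ S} (1 - aX)` determines the multiset `S` of
  non-zero entries (roots are the inverses).
* `satake_eq_chains_of_prod_eq` — the identity forces `α = {u_i q^t : i, 0 ≤ t < m_i}` (telescoping
  + the min-modulus lemma); in particular `∑ m_i = card α = n`: every block of `P_{w₀}` is an
  UNRAMIFIED-character Steinberg block.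
* `blocks_trivial_of_prod_eq` — if moreover no two entries of `α` have ratio `q` (irreducibility of
  the generic unramified principal series `π_{v₀}`, Bernstein–Zelevinsky), then every `m_i = 1` and
  `α = {u_i}`: `P_{w₀}` is the irreducible unramified principal series with Satake parameter `α`,
  i.e. `t_{P,w₀} = t_{π,v₀}` — clause (R).
* `blocks_trivial_of_prod_eq_smul` — the same allowing an a-priori constant (it is `1`, evaluate at
  `X = 0`), the form delivered by the prime separation.

Helper for the item (does not close it): the automorphic inputs of the line (global functional
equation with the Jacquet–Piatetski-Shapiro–Shalika local factors of generic representations,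
genericity of cuspidal representations, the archimedean matching or its replacement by a pair of
twists) are named-fact-sized and are NOT asserted here.

## References

* R. Godement, H. Jacquet, *Zeta functions of simple algebras*, LNM 260 (1972), Thm. 13.8.
  [GodementJacquet1972]
* H. Jacquet, I. Piatetski-Shapiro, J. Shalika, *Rankin–Selberg convolutions*, Amer. J. Math. 105
  (1983), §8 (local factors of generic representations). [JPSS1983]
* J. Arthur, L. Clozel, Ann. of Math. Stud. 120 (1989), Ch. 3, Thm. 5.1. [ArthurClozelAMS120]
-/

set_option linter.dupNamespace false -- project-wide option (lakefile weak.linter.dupNamespace); `Summit.Langlands.Langlands` is the mandated namespace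

open Polynomial

namespace Summit.Langlands.Langlands.Theorems.SkinnerWilesDefectOne.StrongLiftingAllFinite

/-! ### The min-modulus lemma -/

/-- **Min-modulus lemma.**  Let `q ∈ ℂ` with `1 < ‖q‖` and let `A`, `B` be finite multisets of
NON-ZERO complex numbers with `A + q•B = q•A + B` (`q•` = multiply every entry by `q`).  Then
`A = B`.  Proof: induction on `card A + card B`; an entry `z` of `A + B` of least modulus cannot be
of the form `q x` with `x ∈ A + B` (`‖x‖ < ‖z‖`), so reading the identity at `z` shows `z ∈ A` and
`z ∈ B`; erase it from both sides.  (The hypothesis `0 ∉ A, B` is needed: `A = {0}`, `B = 0`.)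
[folklore] -/
theorem multiset_eq_of_add_map_mul_eq {q : ℂ} (hq : 1 < ‖q‖) {A B : Multiset ℂ}
    (hA : (0 : ℂ) ∉ A) (hB : (0 : ℂ) ∉ B)
    (h : A + B.map (q * ·) = A.map (q * ·) + B) : A = B := by
  classical
  suffices key : ∀ (n : ℕ) (A B : Multiset ℂ), A.card + B.card = n → (0 : ℂ) ∉ A → (0 : ℂ) ∉ B →
      A + B.map (q * ·) = A.map (q * ·) + B → A = B from key _ A B rfl hA hB h
  intro n
  induction n using Nat.strong_induction_on with
  | _ n ih =>
    intro A B hn hA hB h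
    by_cases hAB : A + B = 0
    · have hc : A.card + B.card = 0 := by simpa using congrArg Multiset.card hAB
      have hA0 : A = 0 := Multiset.card_eq_zero.mp (by omega)
      have hB0 : B = 0 := Multiset.card_eq_zero.mp (by omega)
      rw [hA0, hB0]
    · have hne : (A + B).toFinset.Nonempty := Multiset.toFinset_nonempty.mpr hAB
      obtain ⟨z, hz, hzmin⟩ := (A + B).toFinset.exists_min_image (fun x => ‖x‖) hne
      rw [Multiset.mem_toFinset] at hz
      have hzmin' : ∀ x ∈ A + B, ‖z‖ ≤ ‖x‖ := fun x hx =>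
        hzmin x (Multiset.mem_toFinset.mpr hx)
      have hz0 : z ≠ 0 := by
        rintro rfl
        rcases Multiset.mem_add.mp hz with h' | h'
        exacts [hA h', hB h']
      -- `z` is not `q * x` for any `x ∈ A + B` (that `x` would have smaller modulus)
      have key : ∀ x ∈ A + B, z ≠ q * x := by
        intro x hx hzx
        have hx0 : x ≠ 0 := by
          rintro rfl
          exact hz0 (by simpa using hzx)
        have hxpos : 0 < ‖x‖ := norm_pos_iff.mpr hx0
        have hlt : ‖x‖ < ‖z‖ := by
          rw [hzx, norm_mul]
          calc ‖x‖ = 1 * ‖x‖ := (one_mul _).symm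
            _ < ‖q‖ * ‖x‖ := mul_lt_mul_of_pos_right hq hxpos
        exact absurd (hzmin' x hx) (not_le.mpr hlt)
      have hzB : z ∈ B := by
        by_contra hzB
        have hzA : z ∈ A := (Multiset.mem_add.mp hz).resolve_right hzB
        have h1 : z ∈ A + B.map (q * ·) := Multiset.mem_add.mpr (Or.inl hzA)
        rw [h] at h1
        rcases Multiset.mem_add.mp h1 with h2 | h2
        · obtain ⟨a, ha, hza⟩ := Multiset.mem_map.mp h2
          exact key a (Multiset.mem_add.mpr (Or.inl ha)) hza.symm
        · exact hzB h2
      have hzA : z ∈ A := by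
        by_contra hzA
        have h1 : z ∈ A.map (q * ·) + B := Multiset.mem_add.mpr (Or.inr hzB)
        rw [← h] at h1
        rcases Multiset.mem_add.mp h1 with h2 | h2
        · exact hzA h2
        · obtain ⟨b, hb, hzb⟩ := Multiset.mem_map.mp h2
          exact key b (Multiset.mem_add.mpr (Or.inr hb)) hzb.symm
      -- erase `z` from both sides and apply the induction hypothesis
      obtain ⟨A', rfl⟩ := Multiset.exists_cons_of_mem hzA
      obtain ⟨B', rfl⟩ := Multiset.exists_cons_of_mem hzB
      have h' : A' + B'.map (q * ·) = A'.map (q * ·) + B' := by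
        have h1 : z ::ₘ ((q * z) ::ₘ (A' + B'.map (q * ·))) =
            z ::ₘ ((q * z) ::ₘ (A'.map (q * ·) + B')) := by
          calc z ::ₘ ((q * z) ::ₘ (A' + B'.map (q * ·)))
              = (z ::ₘ A') + Multiset.map (q * ·) (z ::ₘ B') := by
                simp only [Multiset.map_cons, Multiset.cons_add, Multiset.add_cons]
                exact Multiset.cons_swap _ _ _
            _ = Multiset.map (q * ·) (z ::ₘ A') + (z ::ₘ B') := h
            _ = z ::ₘ ((q * z) ::ₘ (A'.map (q * ·) + B')) := by
                simp only [Multiset.map_cons, Multiset.cons_add, Multiset.add_cons]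
        exact (Multiset.cons_inj_right _).mp ((Multiset.cons_inj_right _).mp h1)
      have hcard : A'.card + B'.card < n := by
        simp only [Multiset.card_cons] at hn
        omega
      have hA' : (0 : ℂ) ∉ A' := fun h0 => hA (Multiset.mem_cons_of_mem h0)
      have hB' : (0 : ℂ) ∉ B' := fun h0 => hB (Multiset.mem_cons_of_mem h0)
      rw [ih _ hcard A' B' rfl hA' hB' h']

/-! ### `∏ (1 - aX)` determines the multiset -/

/-- The factors `1 - aX` are non-zero polynomials (constant coefficient `1`). [folklore] -/
theorem one_sub_C_mul_X_ne_zero (a : ℂ) : (1 - C a * X : ℂ[X]) ≠ 0 := by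
  intro h
  have := congrArg (Polynomial.eval 0) h
  simp at this

/-- The roots of `∏_{a ∈ S} (1 - aX)` for a multiset `S` of non-zero complex numbers are the
inverses `S.map (·⁻¹)`. [folklore] -/
theorem roots_prod_one_sub_C_mul_X {S : Multiset ℂ} (hS : (0 : ℂ) ∉ S) :
    (S.map fun a => (1 - C a * X : ℂ[X])).prod.roots = S.map (·⁻¹) := by
  rw [Polynomial.roots_multiset_prod]
  · rw [Multiset.bind_map]
    have hc : ∀ a ∈ S, (1 - C a * X : ℂ[X]).roots = ({a⁻¹} : Multiset ℂ) := by
      intro a ha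
      have ha0 : a ≠ 0 := fun h0 => hS (h0 ▸ ha)
      have e : (1 - C a * X : ℂ[X]) = -(C a * X - C 1) := by
        rw [map_one]; ring
      rw [e, Polynomial.roots_neg, Polynomial.roots_C_mul_X_sub_C _ ha0, mul_one]
    rw [Multiset.bind_congr hc, Multiset.bind_singleton]
  · intro h0
    obtain ⟨a, -, ha⟩ := Multiset.mem_map.mp h0
    exact one_sub_C_mul_X_ne_zero a ha

/-- **`∏_{a ∈ S} (1 - aX)` determines `S`** (entries non-zero): equal products have equal root
multisets `S.map (·⁻¹) = T.map (·⁻¹)`, and inversion is injective. [folklore] -/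
theorem multiset_eq_of_prod_one_sub_C_mul_X_eq {S T : Multiset ℂ} (hS : (0 : ℂ) ∉ S)
    (hT : (0 : ℂ) ∉ T)
    (h : (S.map fun a => (1 - C a * X : ℂ[X])).prod = (T.map fun a => (1 - C a * X : ℂ[X])).prod) :
    S = T := by
  have h1 := congrArg Polynomial.roots h
  rw [roots_prod_one_sub_C_mul_X hS, roots_prod_one_sub_C_mul_X hT] at h1
  exact Multiset.map_injective inv_injective h1

/-! ### The chains `{u q^t : t < m}` and the telescoping identity -/

/-- **Telescoping**: `q • {u q^t : t < m} + {u} = {u q^t : t < m} + {u q^m}` (both sides are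
`{u q^t : t ≤ m}`). [folklore] -/
theorem chain_telescope (q u : ℂ) (m : ℕ) :
    ((Multiset.range m).map fun t => u * q ^ t).map (q * ·) + {u} =
      ((Multiset.range m).map fun t => u * q ^ t) + {u * q ^ m} := by
  induction m with
  | zero => simp
  | succ m ih =>
    rw [Multiset.range_succ, Multiset.map_cons, Multiset.map_cons, Multiset.cons_add, ih]
    simp only [← Multiset.singleton_add]
    ring_nf
    abel

/-- The entries of a chain `{u q^t : t < m}` are non-zero when `u, q ≠ 0`. [folklore] -/
theorem zero_not_mem_chain {q u : ℂ} (hq : q ≠ 0) (hu : u ≠ 0) (m : ℕ) :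
    (0 : ℂ) ∉ (Multiset.range m).map fun t => u * q ^ t := by
  intro h
  obtain ⟨t, -, ht⟩ := Multiset.mem_map.mp h
  exact mul_ne_zero hu (pow_ne_zero t hq) ht

/-! ### Rigidity of the single-prime identity -/

section Blocks

variable {ι : Type*} [Fintype ι]

/-- **The single-prime identity forces `α` to be the union of the chains.**  Let `1 < ‖q‖`, `α` a
multiset of non-zero complex numbers (the Satake parameter of `π_{v₀}`), and `(u_i, m_i)_{i ∈ ι}`
blocks with `u_i ≠ 0` (the Euler-factor parameters and lengths of the Steinberg blocks of the lift
at `w₀`).  If, as multisets, `α + {u_i q^{m_i}}_i = q•α + {u_i}_i` (the zero/pole bookkeeping of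
`∏(1 - aX) ∏(1 - u_i q^{m_i} X) = ∏(1 - qaX) ∏(1 - u_i X)`), then `α = ∑_i {u_i q^t : t < m_i}`; in
particular `card α = ∑ m_i`.  Proof: with `B = ∑_i {u_i q^t : t < m_i}` the telescoping identity gives
`q•B + {u_i} = B + {u_i q^{m_i}}`; adding and cancelling, `α + q•B = q•α + B`, and the min-modulus
lemma concludes. [folklore] -/
theorem satake_eq_chains_of_multiset_eq {q : ℂ} (hq : 1 < ‖q‖) {α : Multiset ℂ}
    (hα : (0 : ℂ) ∉ α) (u : ι → ℂ) (m : ι → ℕ) (hu : ∀ i, u i ≠ 0)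
    (h : α + ∑ i, ({u i * q ^ m i} : Multiset ℂ) = α.map (q * ·) + ∑ i, ({u i} : Multiset ℂ)) :
    α = ∑ i, (Multiset.range (m i)).map fun t => u i * q ^ t := by
  have hq0 : q ≠ 0 := by
    rintro rfl
    norm_num at hq
  set B : Multiset ℂ := ∑ i, (Multiset.range (m i)).map fun t => u i * q ^ t with hBdef
  -- telescoping, summed over the blocks
  have htel : B.map (q * ·) + ∑ i, ({u i} : Multiset ℂ) = B + ∑ i, ({u i * q ^ m i} : Multiset ℂ) := by
    have hmap : B.map (q * ·) = ∑ i, ((Multiset.range (m i)).map fun t => u i * q ^ t).map (q * ·) :=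
      map_sum (Multiset.mapAddMonoidHom (q * ·)) _ _
    rw [hmap, ← Finset.sum_add_distrib, ← Finset.sum_add_distrib]
    exact Finset.sum_congr rfl fun i _ => chain_telescope q (u i) (m i)
  -- add the two identities and cancel
  have hsum : α + B.map (q * ·) + (∑ i, ({u i} : Multiset ℂ) + ∑ i, ({u i * q ^ m i} : Multiset ℂ)) =
      α.map (q * ·) + B + (∑ i, ({u i} : Multiset ℂ) + ∑ i, ({u i * q ^ m i} : Multiset ℂ)) := by
    calc α + B.map (q * ·) + (∑ i, ({u i} : Multiset ℂ) + ∑ i, ({u i * q ^ m i} : Multiset ℂ))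
        = (α + ∑ i, ({u i * q ^ m i} : Multiset ℂ)) + (B.map (q * ·) + ∑ i, ({u i} : Multiset ℂ)) := by
          abel
      _ = (α.map (q * ·) + ∑ i, ({u i} : Multiset ℂ)) + (B + ∑ i, ({u i * q ^ m i} : Multiset ℂ)) := by
          rw [h, htel]
      _ = α.map (q * ·) + B + (∑ i, ({u i} : Multiset ℂ) + ∑ i, ({u i * q ^ m i} : Multiset ℂ)) := by
          abel
  have hcancel : α + B.map (q * ·) = α.map (q * ·) + B := add_right_cancel hsum
  have hB0 : (0 : ℂ) ∉ B := by
    intro h0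
    rw [hBdef] at h0
    obtain ⟨i, -, hi⟩ := Multiset.mem_sum.mp h0
    exact zero_not_mem_chain hq0 (hu i) (m i) hi
  exact multiset_eq_of_add_map_mul_eq hq hα hB0 hcancel

/-- **Rigidity, polynomial form.**  Same conclusion from the polynomial identity
`∏_{a ∈ α} (1 - aX) · ∏_i (1 - u_i q^{m_i} X) = ∏_{a ∈ α} (1 - qaX) · ∏_i (1 - u_i X)` in `ℂ[X]`
(roots ↦ multisets, `multiset_eq_of_prod_one_sub_C_mul_X_eq`). [folklore] -/
theorem satake_eq_chains_of_prod_eq {q : ℂ} (hq : 1 < ‖q‖) {α : Multiset ℂ}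
    (hα : (0 : ℂ) ∉ α) (u : ι → ℂ) (m : ι → ℕ) (hu : ∀ i, u i ≠ 0)
    (h : (α.map fun a => (1 - C a * X : ℂ[X])).prod * ∏ i, (1 - C (u i * q ^ m i) * X) =
      (α.map fun a => (1 - C (q * a) * X : ℂ[X])).prod * ∏ i, (1 - C (u i) * X)) :
    α = ∑ i, (Multiset.range (m i)).map fun t => u i * q ^ t := by
  classical
  have hq0 : q ≠ 0 := by
    rintro rfl
    norm_num at hq
  apply satake_eq_chains_of_multiset_eq hq hα u m hu
  apply multiset_eq_of_prod_one_sub_C_mul_X_eq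
  · intro h0
    rcases Multiset.mem_add.mp h0 with h1 | h1
    · exact hα h1
    · obtain ⟨i, -, hi⟩ := Multiset.mem_sum.mp h1
      rw [Multiset.mem_singleton] at hi
      exact mul_ne_zero (hu i) (pow_ne_zero _ hq0) hi.symm
  · intro h0
    rcases Multiset.mem_add.mp h0 with h1 | h1
    · obtain ⟨a, ha, hqa⟩ := Multiset.mem_map.mp h1
      exact mul_ne_zero hq0 (fun h' => hα (h' ▸ ha)) hqa
    · obtain ⟨i, -, hi⟩ := Multiset.mem_sum.mp h1
      rw [Multiset.mem_singleton] at hi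
      exact hu i hi.symm
  · -- rewrite both products as products over the combined multisets
    rw [Multiset.map_add, Multiset.prod_add, Multiset.map_add, Multiset.prod_add, Multiset.map_map]
    have e1 : ((∑ i, ({u i * q ^ m i} : Multiset ℂ)).map fun a => (1 - C a * X : ℂ[X])).prod =
        ∏ i, (1 - C (u i * q ^ m i) * X) := by
      have hms : ((∑ i, ({u i * q ^ m i} : Multiset ℂ)).map fun a => (1 - C a * X : ℂ[X])) =
          ∑ i, ({u i * q ^ m i} : Multiset ℂ).map fun a => (1 - C a * X : ℂ[X]) :=
        map_sum (Multiset.mapAddMonoidHom fun a => (1 - C a * X : ℂ[X])) _ _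
      rw [hms, Multiset.prod_sum]
      simp
    have e2 : ((∑ i, ({u i} : Multiset ℂ)).map fun a => (1 - C a * X : ℂ[X])).prod =
        ∏ i, (1 - C (u i) * X) := by
      have hms : ((∑ i, ({u i} : Multiset ℂ)).map fun a => (1 - C a * X : ℂ[X])) =
          ∑ i, ({u i} : Multiset ℂ).map fun a => (1 - C a * X : ℂ[X]) :=
        map_sum (Multiset.mapAddMonoidHom fun a => (1 - C a * X : ℂ[X])) _ _
      rw [hms, Multiset.prod_sum]
      simp
    rw [e1, e2]
    exact h

/-- **Clause (R) from the identity and genericity.**  If in addition no two entries of `α` have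
ratio `q` (`b ≠ q a` for `a, b ∈ α` — for the Satake parameter of a GENERIC spherical
representation this is the irreducibility of its unramified principal series), then every block has
length `m_i = 1` and `α = {u_i}_i`: the local factor of the lift at `w₀` is `∏_{a ∈ α} (1 - a q^{-s})⁻¹`
with `card α` unramified-character blocks of length one — the lift is the irreducible unramified
principal series with Satake parameter `α`, `t_{P,w₀} = t_{π,v₀}`.  Proof: a block with `m_i ≥ 2`
would put `u_i` and `u_i q` into `α`. [folklore] -/
theorem blocks_trivial_of_prod_eq {q : ℂ} (hq : 1 < ‖q‖) {α : Multiset ℂ}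
    (hα : (0 : ℂ) ∉ α) (hgen : ∀ a ∈ α, ∀ b ∈ α, b ≠ q * a) (u : ι → ℂ) (m : ι → ℕ)
    (hu : ∀ i, u i ≠ 0) (hm : ∀ i, 1 ≤ m i)
    (h : (α.map fun a => (1 - C a * X : ℂ[X])).prod * ∏ i, (1 - C (u i * q ^ m i) * X) =
      (α.map fun a => (1 - C (q * a) * X : ℂ[X])).prod * ∏ i, (1 - C (u i) * X)) :
    (∀ i, m i = 1) ∧ α = ∑ i, ({u i} : Multiset ℂ) := by
  have hαB := satake_eq_chains_of_prod_eq hq hα u m hu h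
  -- every chain is contained in `α`
  have hmem : ∀ i, ∀ t < m i, u i * q ^ t ∈ α := by
    intro i t ht
    rw [hαB]
    exact Multiset.mem_sum.mpr ⟨i, Finset.mem_univ i,
      Multiset.mem_map.mpr ⟨t, Multiset.mem_range.mpr ht, rfl⟩⟩
  have hm1 : ∀ i, m i = 1 := by
    intro i
    by_contra hne
    have h2 : 2 ≤ m i := by have := hm i; omega
    have h0 : u i * q ^ 0 ∈ α := hmem i 0 (by omega)
    have h1 : u i * q ^ 1 ∈ α := hmem i 1 (by omega)
    exact hgen _ h0 _ h1 (by ring)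
  refine ⟨hm1, ?_⟩
  rw [hαB]
  exact Finset.sum_congr rfl fun i _ => by simp [hm1 i]

/-- **Clause (R), with an a-priori constant** (the shape delivered by the prime separation): if
`∏_{a ∈ α} (1 - aX) · ∏_i (1 - u_i q^{m_i} X) = c · ∏_{a ∈ α} (1 - qaX) · ∏_i (1 - u_i X)` for some
`c ∈ ℂ`, then `c = 1` (constant coefficients) and the conclusion of `blocks_trivial_of_prod_eq`
holds. [folklore] -/
theorem blocks_trivial_of_prod_eq_smul {q : ℂ} (hq : 1 < ‖q‖) {α : Multiset ℂ}
    (hα : (0 : ℂ) ∉ α) (hgen : ∀ a ∈ α, ∀ b ∈ α, b ≠ q * a) (u : ι → ℂ) (m : ι → ℕ)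
    (hu : ∀ i, u i ≠ 0) (hm : ∀ i, 1 ≤ m i) (c : ℂ)
    (h : (α.map fun a => (1 - C a * X : ℂ[X])).prod * ∏ i, (1 - C (u i * q ^ m i) * X) =
      c • ((α.map fun a => (1 - C (q * a) * X : ℂ[X])).prod * ∏ i, (1 - C (u i) * X))) :
    c = 1 ∧ (∀ i, m i = 1) ∧ α = ∑ i, ({u i} : Multiset ℂ) := by
  -- evaluate at `X = 0`: every factor has constant coefficient `1`
  have hL : Polynomial.eval 0 ((α.map fun a => (1 - C a * X : ℂ[X])).prod *
      ∏ i, (1 - C (u i * q ^ m i) * X)) = 1 := by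
    simp [Polynomial.eval_multiset_prod, Polynomial.eval_prod]
  have hR : Polynomial.eval 0 ((α.map fun a => (1 - C (q * a) * X : ℂ[X])).prod *
      ∏ i, (1 - C (u i) * X)) = 1 := by
    simp [Polynomial.eval_multiset_prod, Polynomial.eval_prod]
  have hc : c = 1 := by
    have := congrArg (Polynomial.eval 0) h
    rw [Polynomial.eval_smul, hL, hR, smul_eq_mul, mul_one] at this
    exact this.symm
  subst hc
  rw [one_smul] at h
  exact ⟨rfl, blocks_trivial_of_prod_eq hq hα hgen u m hu hm h⟩

end Blocks

end Summit.Langlands.Langlands.Theorems.SkinnerWilesDefectOne.StrongLiftingAllFinite
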